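import Summits.Parity.GeneralizedHardyLittlewood.Theorems.PrimeLevelFamEdgeMomentsBeyondDiagonalDiagDecorMomentFamily
import HarnessLib

/-!
# Route `PrimeLevelFamEdge`, crux K_A `MomentsBeyondDiagonal` (stmt-Parity-20007), line «petersson_layers» v4, stub `stub_diag`:
# **the every-order decorated family bounds IN THE DECORATIONS OF THE GENERIC HECKE EXPANSION** — `Σ_{d∣k}(2log d − log k)^t`, the
# arithmetic factor of `…DiagDecorOrderHecke.heckeSum_order_eq i j`

Third brick of the generic order `(i,j)` of `stub_diag` (census `Lines/petersson_layers_stub_diag_g18_rung4.md`, items (G1)/(G2)). The generic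
Hecke summation `heckeSum_order_eq i j` writes the order-`(i,j)` weight with the decorations `H_t(k) = Σ_{d∣k}(2log d − log k)^t`; the every-order
family bounds of `…DiagDecorMomentFamily` are stated with `τ(k)·m_t(k)`, `m_t(k) = S_t(k)/τ(k)`, `S_t(k) = Σ_{de=k}(log d − log e)^t`. Since
`2log d − log k = log d − log(k/d)`, `H_t = S_t = τ·m_t` exactly (`k ≥ 1`): this file records the identity and restates the three family
bounds in the `H_t` form the generic assembly meets, so that EVERY decorated monomial of EVERY order `(i,j)` with a decoration of degree
`t ≥ 4` on either side is bounded by one `exact`: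

* `sum_divisors_two_mul_log_sub_log_pow_eq` — `Σ_{d∣k}(2log d − log k)^t = τ(k)·(S_t(k)/τ(k))` (`k ≥ 1`);
* `abs_selbergHeckeTau_Lpow_le` / `abs_selbergTauHecke_Lpow_le` — **`|Sel(H_t(k₁)·τ(k₂)·L^m)| ≤ C·log^m M`** and the mirror (every `t`,
  every `m`; `P₀ = P₁ = 0`, `0 ≤ λ ≤ 1`, `M ≥ 3`);
* `abs_selbergHeckeHecke_Lpow_le` — **`|Sel(H_t(k₁)·H_{t′}(k₂)·L^m)| ≤ C·log^{m+1}M`** (every `t, t′, m`; any `P`).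

(For the orders that matter these are used with `t ≥ 4`, resp. `t + t′ ≥ 6` with `t, t′ ≥ 2`; `t ∈ {0, 2}` carry main terms and have their
own engines.) Def-free; theorems only. Helper `--supports stmt-Parity-20007`; closes nothing; K_A, K_B and the Parity summit are NOT
proved; nothing about Landau–Siegel zeros.

## References
* E. Kowalski, P. Michel, J. VanderKam, J. reine angew. Math. 526 (2000), (23)–(28) pp. 13–15 and Prop. 5.1 p. 18.
  [cite: KowalskiMichelVanderKam2000, (23)–(28) — derivation (Hecke-divisor decorations of the order-(i,j) diagonal weight)]
-/

noncomputable section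

open scoped Real ArithmeticFunction.Moebius
open Finset ArithmeticFunction Polynomial

namespace Summit.Parity.GeneralizedHardyLittlewood.Theorems.MomentsBeyondDiagonal.DiagKernel

open Literature.NumberTheory.LFunctions Literature.NumberTheory.LFunctions.KMV2000
open MollifierMainTerm (W)

/-- **`Σ_{d∣k}(2log d − log k)^t = τ(k)·(S_t(k)/τ(k))`, `S_t(k) = Σ_{de=k}(log d − log e)^t`** (`k ≥ 1`). [folklore] -/
theorem sum_divisors_two_mul_log_sub_log_pow_eq (t : ℕ) {k : ℕ} (hk : k ≠ 0) :
    ∑ d ∈ k.divisors, (2 * Real.log d - Real.log k) ^ t =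
      (k.divisors.card : ℝ) * ((∑ z ∈ k.divisorsAntidiagonal, (Real.log z.1 - Real.log z.2) ^ t) / (k.divisors.card : ℝ)) := by
  have hτ : (k.divisors.card : ℝ) ≠ 0 := by
    have : 0 < k.divisors.card := Finset.card_pos.2 ⟨k, Nat.mem_divisors_self k hk⟩
    exact_mod_cast this.ne'
  rw [mul_div_cancel₀ _ hτ, Nat.sum_divisorsAntidiagonal fun a b ↦ (Real.log a - Real.log b) ^ t]
  refine Finset.sum_congr rfl fun d hd ↦ ?_
  have hdk : d ∣ k := Nat.dvd_of_mem_divisors hd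
  have hd0 : d ≠ 0 := ne_zero_of_dvd_ne_zero hk hdk
  have hd0' : (d : ℝ) ≠ 0 := by exact_mod_cast hd0
  have hk0' : (k : ℝ) ≠ 0 := by exact_mod_cast hk
  rw [Nat.cast_div hdk hd0', Real.log_div hk0' hd0']
  ring

variable (P : ℝ[X])

/-- **One-sided family in Hecke decorations, decoration on `k₁`: `|Sel(H_t(k₁)·τ(k₂)·L^m)| ≤ C·log^m M`** (every `t`, `m`).
[cite: KowalskiMichelVanderKam2000, (23)–(28) — derivation (diagonal main term in real Selberg coordinates)] -/
theorem abs_selbergHeckeTau_Lpow_le (t : ℕ) (hP0 : P.coeff 0 = 0) (hP1 : P.coeff 1 = 0) (m : ℕ)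
    {lam : ℝ} (hlam0 : 0 ≤ lam) (hlam1 : lam ≤ 1) :
    ∃ C : ℝ, 0 < C ∧ ∀ M : ℝ, 3 ≤ M →
      |∑ c ∈ Icc 1 ⌊M⌋₊, ∑ g ∈ Icc 1 (⌊M⌋₊ / c), (μ g : ℝ) * c *
          ∑ k₁ ∈ Icc 1 (⌊M⌋₊ / (c * g)), ∑ k₂ ∈ Icc 1 (⌊M⌋₊ / (c * g)),
            ((μ (c * g * k₁) : ℝ) * ((psi (c * g * k₁))⁻¹ *
                P.eval (Real.log (M / ((c * g * k₁ : ℕ) : ℝ)) / Real.log M))) / ((c * g * k₁ : ℕ) : ℝ) *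
              (((μ (c * g * k₂) : ℝ) * ((psi (c * g * k₂))⁻¹ *
                P.eval (Real.log (M / ((c * g * k₂ : ℕ) : ℝ)) / Real.log M))) / ((c * g * k₂ : ℕ) : ℝ)) *
              ((∑ d ∈ k₁.divisors, (2 * Real.log d - Real.log k₁) ^ t) *
                (k₂.divisors.card : ℝ) * (2 * (lam * Real.log M) - 2 * Real.log g - Real.log k₁ - Real.log k₂) ^ m)| ≤
        C * Real.log M ^ m := by
  obtain ⟨C, hC, h⟩ := abs_selbergMomentTau_Lpow_le t P hP0 hP1 m hlam0 hlam1
  refine ⟨C, hC, fun M hM ↦ ?_⟩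
  refine le_of_eq_of_le (congrArg abs ?_) (h M hM)
  refine Finset.sum_congr rfl fun c hc ↦ Finset.sum_congr rfl fun g hg ↦ ?_
  congr 1
  refine Finset.sum_congr rfl fun k₁ hk₁ ↦ Finset.sum_congr rfl fun k₂ hk₂ ↦ ?_
  have hk₁0 : k₁ ≠ 0 := by have := (Finset.mem_Icc.1 hk₁).1; omega
  rw [sum_divisors_two_mul_log_sub_log_pow_eq t hk₁0]

/-- **One-sided family in Hecke decorations, decoration on `k₂`: `|Sel(τ(k₁)·H_t(k₂)·L^m)| ≤ C·log^m M`** (every `t`, `m`).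
[cite: KowalskiMichelVanderKam2000, (23)–(28) — derivation (diagonal main term in real Selberg coordinates)] -/
theorem abs_selbergTauHecke_Lpow_le (t : ℕ) (hP0 : P.coeff 0 = 0) (hP1 : P.coeff 1 = 0) (m : ℕ)
    {lam : ℝ} (hlam0 : 0 ≤ lam) (hlam1 : lam ≤ 1) :
    ∃ C : ℝ, 0 < C ∧ ∀ M : ℝ, 3 ≤ M →
      |∑ c ∈ Icc 1 ⌊M⌋₊, ∑ g ∈ Icc 1 (⌊M⌋₊ / c), (μ g : ℝ) * c *
          ∑ k₁ ∈ Icc 1 (⌊M⌋₊ / (c * g)), ∑ k₂ ∈ Icc 1 (⌊M⌋₊ / (c * g)),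
            ((μ (c * g * k₁) : ℝ) * ((psi (c * g * k₁))⁻¹ *
                P.eval (Real.log (M / ((c * g * k₁ : ℕ) : ℝ)) / Real.log M))) / ((c * g * k₁ : ℕ) : ℝ) *
              (((μ (c * g * k₂) : ℝ) * ((psi (c * g * k₂))⁻¹ *
                P.eval (Real.log (M / ((c * g * k₂ : ℕ) : ℝ)) / Real.log M))) / ((c * g * k₂ : ℕ) : ℝ)) *
              ((k₁.divisors.card : ℝ) * (∑ d ∈ k₂.divisors, (2 * Real.log d - Real.log k₂) ^ t) *
                (2 * (lam * Real.log M) - 2 * Real.log g - Real.log k₁ - Real.log k₂) ^ m)| ≤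
        C * Real.log M ^ m := by
  obtain ⟨C, hC, h⟩ := abs_selbergTauMoment_Lpow_le t P hP0 hP1 m hlam0 hlam1
  refine ⟨C, hC, fun M hM ↦ ?_⟩
  refine le_of_eq_of_le (congrArg abs ?_) (h M hM)
  refine Finset.sum_congr rfl fun c hc ↦ Finset.sum_congr rfl fun g hg ↦ ?_
  congr 1
  refine Finset.sum_congr rfl fun k₁ hk₁ ↦ Finset.sum_congr rfl fun k₂ hk₂ ↦ ?_
  have hk₂0 : k₂ ≠ 0 := by have := (Finset.mem_Icc.1 hk₂).1; omega
  rw [sum_divisors_two_mul_log_sub_log_pow_eq t hk₂0]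

/-- **Two-sided family in Hecke decorations: `|Sel(H_t(k₁)·H_{t′}(k₂)·L^m)| ≤ C·log^{m+1}M`** (every `t, t′, m`; any `P`).
[cite: KowalskiMichelVanderKam2000, (23)–(28) — derivation (diagonal main term in real Selberg coordinates)] -/
theorem abs_selbergHeckeHecke_Lpow_le (t t' : ℕ) (m : ℕ) {lam : ℝ} (hlam0 : 0 ≤ lam) (hlam1 : lam ≤ 1) :
    ∃ C : ℝ, 0 < C ∧ ∀ M : ℝ, 3 ≤ M →
      |∑ c ∈ Icc 1 ⌊M⌋₊, ∑ g ∈ Icc 1 (⌊M⌋₊ / c), (μ g : ℝ) * c *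
          ∑ k₁ ∈ Icc 1 (⌊M⌋₊ / (c * g)), ∑ k₂ ∈ Icc 1 (⌊M⌋₊ / (c * g)),
            ((μ (c * g * k₁) : ℝ) * ((psi (c * g * k₁))⁻¹ *
                P.eval (Real.log (M / ((c * g * k₁ : ℕ) : ℝ)) / Real.log M))) / ((c * g * k₁ : ℕ) : ℝ) *
              (((μ (c * g * k₂) : ℝ) * ((psi (c * g * k₂))⁻¹ *
                P.eval (Real.log (M / ((c * g * k₂ : ℕ) : ℝ)) / Real.log M))) / ((c * g * k₂ : ℕ) : ℝ)) *
              ((∑ d ∈ k₁.divisors, (2 * Real.log d - Real.log k₁) ^ t) * (∑ d ∈ k₂.divisors, (2 * Real.log d - Real.log k₂) ^ t') *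
                (2 * (lam * Real.log M) - 2 * Real.log g - Real.log k₁ - Real.log k₂) ^ m)| ≤
        C * Real.log M ^ (m + 1) := by
  obtain ⟨C, hC, h⟩ := abs_selbergMomentMoment_Lpow_le t t' P m hlam0 hlam1
  refine ⟨C, hC, fun M hM ↦ ?_⟩
  refine le_of_eq_of_le (congrArg abs ?_) (h M hM)
  refine Finset.sum_congr rfl fun c hc ↦ Finset.sum_congr rfl fun g hg ↦ ?_
  congr 1
  refine Finset.sum_congr rfl fun k₁ hk₁ ↦ Finset.sum_congr rfl fun k₂ hk₂ ↦ ?_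
  have hk₁0 : k₁ ≠ 0 := by have := (Finset.mem_Icc.1 hk₁).1; omega
  have hk₂0 : k₂ ≠ 0 := by have := (Finset.mem_Icc.1 hk₂).1; omega
  rw [sum_divisors_two_mul_log_sub_log_pow_eq t hk₁0, sum_divisors_two_mul_log_sub_log_pow_eq t' hk₂0]

end Summit.Parity.GeneralizedHardyLittlewood.Theorems.MomentsBeyondDiagonal.DiagKernel

end
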